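import Literature.NumberTheory.LFunctions.SchoenfeldBrentSieve
import HarnessLib

/-!
# Brent's range of Schoenfeld 1976, Cor. 1: soundness of the survivor mask and of the counts

Topic: `Literature/NumberTheory/LFunctions`. Second part of the soundness proof of the checker of
`SchoenfeldBrentSieve.lean` (discharge of `Literature.NumberTheory.LFunctions.Schoenfeld1976_brentRange`,
L. Schoenfeld, Math. Comp. 30 (1976), proof of Cor. 1, p. 340; R. P. Brent, Math. Comp. 29 (1975),
Table 1):

* **survivors.** `testBit_surv`: bit `i` of `surv prs N` is set iff `i < L` and no shifted pattern hits
  `i`; `testBit_surv_iff_prime`: for an admissible base (`Even N`, `PMAX < N`, `N + 2L ≤ PMAX²`) the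
  set bits are exactly the primes `N + 1 + 2i` (a composite odd number below `PMAX²` has an odd prime
  factor `≤ PMAX`, which is in the list by `mem_sievePrimes`);
* **bit counts.** `bits x n = #{i < n | bit i of x}`; the table/halving counter is exact:
  `popTree k y = bits y (64·2^k)` (no size hypothesis: higher bits are simply not counted),
  `rangeCount x j w = bits (x >>> j) w` (`w ≤ L`);
* **primes of a segment.** `isPrimeR (surv pats N) r ↔ (N + r).Prime` and
  `primesInR (surv pats N) r₁ r₂ = π(N + r₂ − 1) − π(N + r₁ − 1)` (as a difference of
  `Nat.count Nat.Prime`), by induction on `r₂` over the parity of `r₂`.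

Everything here is proved; no new definitions except the specification `bits`.

## References

* L. Schoenfeld, Math. Comp. 30 (1976), 337–360, proof of Cor. 1 (p. 340). [Schoenfeld1976]
* R. P. Brent, Math. Comp. 29 (1975), 43–56, Table 1. [Brent1975]
-/

open Finset
open Literature.Analysis.SpecialFunctions.KernelLog
open Literature.Analysis.ValidatedNumerics.Numerics (cdiv fdiv_le_div div_le_cdiv)

namespace Literature.NumberTheory.LFunctions

namespace BrentSieve

open SchoenfeldSieve SchoenfeldNumerics PrimeTable

section Soundness

/-! ### The survivor mask -/

/-- Bit semantics of the OR-accumulation. [folklore] -/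
theorem testBit_sieveAcc (N : ℕ) : ∀ (prs : List (ℕ × ℕ)) (acc i : ℕ),
    (sieveAcc N prs acc).testBit i = true ↔
      acc.testBit i = true ∨ ∃ pr ∈ prs, (pr.2 <<< firstIdx N pr.1).testBit i = true
  | [], acc, i => by simp [sieveAcc]
  | pr :: prs, acc, i => by
      rw [sieveAcc, testBit_sieveAcc N prs, Nat.testBit_or, Bool.or_eq_true]
      simp only [List.mem_cons, exists_eq_or_imp]
      tauto

/-- **Bit semantics of the survivor mask**: bit `i` of `surv prs N` is set iff `i < L` and no shifted
pattern of the list hits `i`. [folklore] -/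
theorem testBit_surv (prs : List (ℕ × ℕ)) (N i : ℕ) :
    (surv prs N).testBit i = true ↔
      i < L ∧ ¬ ∃ pr ∈ prs, (pr.2 <<< firstIdx N pr.1).testBit i = true := by
  unfold surv
  rw [Nat.testBit_xor, Nat.testBit_and, testBit_allOnes]
  have h := testBit_sieveAcc N prs 0 i
  simp only [Nat.zero_testBit, Bool.false_eq_true, false_or] at h
  have key : ∀ (a b : Bool), ((a ^^ (b && a)) = true ↔ (a = true ∧ ¬ b = true)) := by decide
  rw [key, decide_eq_true_eq, h]

/-- With the list `pats`: bit `i < L` of `surv pats N` is clear iff some sieving prime divides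
`N + 1 + 2i`. [folklore] -/
theorem testBit_surv_pats (N : ℕ) {i : ℕ} (hi : i < L) :
    (surv pats N).testBit i = true ↔ ∀ p ∈ sievePrimes, ¬ p ∣ N + 1 + 2 * i := by
  rw [testBit_surv]
  simp only [hi, true_and, pats, List.mem_map, not_exists, not_and]
  constructor
  · intro h p hp hd
    obtain ⟨_, _, hodd, _⟩ := mem_sievePrimes.1 hp
    obtain ⟨h1, h2⟩ := (dvd_iff_firstIdx N hodd i).1 hd
    refine h (p, patR p) ⟨p, hp, rfl⟩ ?_
    dsimp only
    rw [Nat.testBit_shiftLeft, Bool.and_eq_true, decide_eq_true_eq, testBit_patR (by omega)]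
    exact ⟨h1, by omega, h2⟩
  · rintro h pr ⟨p, hp, rfl⟩ hb
    obtain ⟨_, _, hodd, _⟩ := mem_sievePrimes.1 hp
    dsimp only at hb
    rw [Nat.testBit_shiftLeft, Bool.and_eq_true, decide_eq_true_eq, testBit_patR (by omega)] at hb
    exact h p hp ((dvd_iff_firstIdx N hodd i).2 ⟨hb.1, hb.2.2⟩)

/-- Bits `i ≥ L` of a survivor mask are clear. [folklore] -/
theorem testBit_surv_of_le (prs : List (ℕ × ℕ)) (N : ℕ) {i : ℕ} (hi : L ≤ i) :
    (surv prs N).testBit i = false := by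
  have := (testBit_surv prs N i).not.2 (by omega)
  simpa using this

/-! ### Survivors are the primes -/

/-- **The sieve is exact**: for an even base `N` with `PMAX < N` and `N + 2L ≤ PMAX²`, bit `i < L` of
`surv pats N` is set iff `N + 1 + 2i` is prime (a composite odd number below `PMAX²` has an odd prime
factor `≤ PMAX`, which is in the list by `mem_sievePrimes`). [folklore] -/
theorem testBit_surv_iff_prime {N : ℕ} (hN : Even N) (hlo : PMAX < N) (hhi : N + 2 * L ≤ PMAX ^ 2)
    {i : ℕ} (hi : i < L) : (surv pats N).testBit i = true ↔ (N + 1 + 2 * i).Prime := by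
  rw [testBit_surv_pats N hi]
  set n := N + 1 + 2 * i with hn
  have hn2 : ¬ 2 ∣ n := by
    obtain ⟨k, hk⟩ := hN
    rw [hn, hk]; omega
  have hnP : PMAX < n := by omega
  have hnsq : n < PMAX ^ 2 + 1 := by omega
  constructor
  · intro h
    by_contra hc
    have hn1 : n ≠ 1 := by omega
    have hmf := Nat.minFac_prime hn1
    have hmd := Nat.minFac_dvd n
    have hsq : n.minFac ^ 2 ≤ n := Nat.minFac_sq_le_self (by omega) hc
    have hm2 : n.minFac ≠ 2 := fun e ↦ hn2 (e ▸ hmd)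
    have hm3 : 3 ≤ n.minFac := by
      have := hmf.two_le
      omega
    have hmP : n.minFac ≤ PMAX := by
      by_contra hc'
      have hc'' : PMAX + 1 ≤ n.minFac := not_le.1 hc'
      have : (PMAX + 1) ^ 2 ≤ n.minFac ^ 2 := Nat.pow_le_pow_left hc'' 2
      nlinarith
    have hodd : n.minFac % 2 = 1 := by
      have := hmf.eq_one_or_self_of_dvd 2
      omega
    exact h _ (mem_sievePrimes.2 ⟨hm3, hmP, hodd, hmf⟩) hmd
  · intro hpr p hp hd
    obtain ⟨h3, hP, _, hpp⟩ := mem_sievePrimes.1 hp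
    have := (Nat.prime_dvd_prime_iff_eq hpp hpr).1 hd
    omega

/-! ### Bit counts -/

/-- The number of set bits of `x` in positions `< n`. [folklore] -/
def bits (x n : ℕ) : ℕ := ((range n).filter fun i ↦ x.testBit i = true).card

/-- `bits x 0 = 0`. [folklore] -/
theorem bits_zero (x : ℕ) : bits x 0 = 0 := by simp [bits]

/-- `bits x (n+1) = bits x n + [bit n]`. [folklore] -/
theorem bits_succ (x n : ℕ) : bits x (n + 1) = bits x n + (if x.testBit n = true then 1 else 0) := by
  unfold bits
  rw [Finset.range_add_one, Finset.filter_insert]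
  split_ifs with h
  · rw [Finset.card_insert_of_notMem (by simp)]
  · rfl

/-- The reference counter agrees with the specification: `bitSum n x = bits x n`. [folklore] -/
theorem bitSum_eq : ∀ (n x : ℕ), bitSum n x = bits x n
  | 0, x => by simp [bitSum, bits_zero]
  | n + 1, x => by
      rw [bitSum, bitSum_eq n x, bits_succ]
      congr 1
      rw [Nat.shiftRight_eq_div_pow, Nat.testBit_eq_decide_div_mod_eq]
      rcases Nat.mod_two_eq_zero_or_one (x / 2 ^ n) with h | h <;> simp [h]

/-- Bits agree below `n` ⟹ equal counts. [folklore] -/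
theorem bits_congr {x y n : ℕ} (h : ∀ i < n, x.testBit i = y.testBit i) : bits x n = bits y n := by
  unfold bits
  congr 1
  exact filter_congr fun i hi ↦ by rw [h i (mem_range.1 hi)]

/-- Splitting a count: `bits x (m + n) = bits x m + bits (x >>> m) n`. [folklore] -/
theorem bits_add (x m : ℕ) : ∀ n : ℕ, bits x (m + n) = bits x m + bits (x >>> m) n
  | 0 => by simp [bits_zero]
  | n + 1 => by
      rw [← add_assoc, bits_succ, bits_add x m n, bits_succ, Nat.testBit_shiftRight]
      ring

/-- Masking above the counted range does not matter. [folklore] -/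
theorem bits_and_mask (x : ℕ) {n m : ℕ} (h : n ≤ m) : bits (x &&& (2 ^ m - 1)) n = bits x n :=
  bits_congr fun i hi ↦ by
    rw [Nat.testBit_and, Nat.testBit_two_pow_sub_one]
    simp [show i < m by omega]

/-- If all bits `≥ n` are clear, counting further adds nothing. [folklore] -/
theorem bits_of_high_zero {x n : ℕ} (hz : ∀ i, n ≤ i → x.testBit i = false) :
    ∀ m, n ≤ m → bits x m = bits x n := by
  refine Nat.le_induction rfl fun m hm ih ↦ ?_
  rw [bits_succ, ih, hz m hm]
  simp

/-- The table entry of a `16`-bit number is its bit count. [folklore] -/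
theorem popTable_getD {y : ℕ} (hy : y < 65536) : popTable[y]?.getD 0 = bits y 16 := by
  have hs : y < popTable.size := by simp [popTable, hy]
  rw [Array.getElem?_eq_getElem hs, Option.getD_some]
  simp [popTable, Array.getElem_ofFn, bitSum_eq]

/-- `y &&& (2¹⁶ − 1) < 65536`. [folklore] -/
theorem and_mask16_lt (y : ℕ) : y &&& (2 ^ 16 - 1) < 65536 := by
  rw [Nat.and_two_pow_sub_one_eq_mod]
  exact Nat.mod_lt _ (by norm_num)

/-- `pop64 y = bits y 64`. [folklore] -/
theorem pop64_eq (y : ℕ) : pop64 y = bits y 64 := by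
  unfold pop64
  rw [popTable_getD (and_mask16_lt _), popTable_getD (and_mask16_lt _),
    popTable_getD (and_mask16_lt _), popTable_getD (and_mask16_lt _),
    bits_and_mask _ le_rfl, bits_and_mask _ le_rfl, bits_and_mask _ le_rfl, bits_and_mask _ le_rfl,
    show (64 : ℕ) = 16 + (16 + (16 + 16)) from rfl, bits_add, bits_add, bits_add,
    ← Nat.shiftRight_add, ← Nat.shiftRight_add]
  ring

/-- **The halving counter is exact**: `popTree k y = bits y (64·2^k)`. [folklore] -/
theorem popTree_eq : ∀ (k y : ℕ), popTree k y = bits y (64 * 2 ^ k)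
  | 0, y => by simpa [popTree] using pop64_eq y
  | k + 1, y => by
      rw [popTree, popTree_eq k, popTree_eq k, bits_and_mask _ le_rfl,
        show 64 * 2 ^ (k + 1) = 64 * 2 ^ k + 64 * 2 ^ k by ring, bits_add]

/-- The depth search: `w ≤ c·2^fuel`, `c = 64·2^k` ⟹ `w ≤ 64·2^(depthGo w fuel k c)`. [folklore] -/
theorem le_depthGo (w : ℕ) : ∀ (fuel k c : ℕ), c = 64 * 2 ^ k → w ≤ c * 2 ^ fuel →
    w ≤ 64 * 2 ^ depthGo w fuel k c
  | 0, k, c, hc, hw => by simpa [depthGo, hc] using hw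
  | fuel + 1, k, c, hc, hw => by
      unfold depthGo
      split_ifs with h
      · rwa [hc] at h
      · exact le_depthGo w fuel (k + 1) (2 * c) (by rw [hc]; ring) (by rw [pow_succ] at hw; linarith)

/-- **Counting a bit range**: `rangeCount x j w = bits (x >>> j) w` for `w ≤ L`. [folklore] -/
theorem rangeCount_eq (x j : ℕ) {w : ℕ} (hw : w ≤ L) : rangeCount x j w = bits (x >>> j) w := by
  unfold rangeCount
  rw [popTree_eq]
  have hd := le_depthGo w 14 0 64 (by norm_num) (by unfold L at hw; omega)
  rw [bits_of_high_zero (x := (x >>> j) &&& (2 ^ w - 1)) (n := w) ?_ _ hd, bits_and_mask _ le_rfl]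
  intro i hi
  rw [Nat.testBit_and, Nat.testBit_two_pow_sub_one]
  simp [show ¬ i < w by omega]

/-! ### The primes of a segment -/

/-- `(S >>> i) % 2 = 1 ↔ bit i`. [folklore] -/
theorem shiftRight_mod_two_eq_one_iff (S i : ℕ) : (S >>> i) % 2 = 1 ↔ S.testBit i = true := by
  rw [Nat.shiftRight_eq_div_pow, Nat.testBit_eq_decide_div_mod_eq, decide_eq_true_eq]

/-- An even number `≥ 4` is not prime. [folklore] -/
theorem not_prime_of_even {b : ℕ} (h2 : 2 ∣ b) (hb : 4 ≤ b) : ¬ b.Prime := fun hp ↦ by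
  have := (Nat.Prime.eq_one_or_self_of_dvd hp 2 h2)
  omega

/-- **Primality inside a segment, read off the mask**: for `1 ≤ r ≤ 2L`,
`isPrimeR (surv pats N) r ↔ N + r` is prime. [folklore] -/
theorem isPrimeR_iff {N : ℕ} (hN : Even N) (hlo : PMAX < N) (hhi : N + 2 * L ≤ PMAX ^ 2)
    {r : ℕ} (hr1 : 1 ≤ r) (hr2 : r ≤ 2 * L) :
    isPrimeR (surv pats N) r = true ↔ (N + r).Prime := by
  unfold isPrimeR
  rw [Bool.and_eq_true, beq_iff_eq, beq_iff_eq, shiftRight_mod_two_eq_one_iff]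
  obtain ⟨k, hk⟩ := hN
  rcases Nat.even_or_odd r with ⟨t, ht⟩ | ⟨t, ht⟩
  · have hnp : ¬ (N + r).Prime := not_prime_of_even ⟨k + t, by omega⟩ (by unfold PMAX at hlo; omega)
    simp [show ¬ r % 2 = 1 by omega, hnp]
  · have hi : r / 2 < L := by omega
    rw [testBit_surv_iff_prime ⟨k, hk⟩ hlo hhi hi, show N + 1 + 2 * (r / 2) = N + r by omega]
    simp [show r % 2 = 1 by omega]

/-- **Prime counts inside a segment**: for `1 ≤ r₁ ≤ r₂ ≤ 2L + 1`,
`primesInR (surv pats N) r₁ r₂ = #{primes in [N + r₁, N + r₂)} = π(N + r₂ − 1) − π(N + r₁ − 1)`.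
[folklore] -/
theorem primesInR_eq {N : ℕ} (hN : Even N) (hlo : PMAX < N) (hhi : N + 2 * L ≤ PMAX ^ 2)
    {r₁ r₂ : ℕ} (h1 : 1 ≤ r₁) (h12 : r₁ ≤ r₂) (h2 : r₂ ≤ 2 * L + 1) :
    primesInR (surv pats N) r₁ r₂ = Nat.count Nat.Prime (N + r₂) - Nat.count Nat.Prime (N + r₁) := by
  unfold primesInR
  set S := surv pats N with hS
  rw [rangeCount_eq _ _ (by omega)]
  -- induction on `r₂`
  suffices H : ∀ r, r₁ ≤ r → r ≤ 2 * L + 1 →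
      bits (S >>> (r₁ / 2)) (r / 2 - r₁ / 2) =
        Nat.count Nat.Prime (N + r) - Nat.count Nat.Prime (N + r₁) from H r₂ h12 h2
  refine Nat.le_induction (fun _ ↦ by simp [bits_zero]) fun r hr ih hr1 ↦ ?_
  have ih' := ih (by omega)
  have hmono : Nat.count Nat.Prime (N + r₁) ≤ Nat.count Nat.Prime (N + r) :=
    Nat.count_monotone _ (by omega)
  obtain ⟨k, hk⟩ := hN
  rw [show N + (r + 1) = (N + r) + 1 by omega, Nat.count_succ]
  rcases Nat.even_or_odd r with ⟨t, ht⟩ | ⟨t, ht⟩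
  · -- `r` even: `N + r` is even, no new slot
    have hnp : ¬ (N + r).Prime := not_prime_of_even ⟨k + t, by omega⟩ (by unfold PMAX at hlo; omega)
    rw [if_neg hnp, show (r + 1) / 2 - r₁ / 2 = r / 2 - r₁ / 2 by omega, ih']
    rfl
  · -- `r` odd: `N + r = N + 1 + 2i` with the new slot `i = r / 2`
    have hi : r / 2 < L := by omega
    have hbi : N + 1 + 2 * (r / 2) = N + r := by omega
    have hw : (r + 1) / 2 - r₁ / 2 = (r / 2 - r₁ / 2) + 1 := by omega
    rw [hw, bits_succ, ih', Nat.testBit_shiftRight, show r₁ / 2 + (r / 2 - r₁ / 2) = r / 2 by omega]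
    have key := testBit_surv_iff_prime ⟨k, hk⟩ hlo hhi hi
    rw [hbi] at key
    by_cases hp : (N + r).Prime
    · rw [if_pos hp, if_pos (key.2 hp)]
      omega
    · have : ¬ S.testBit (r / 2) = true := fun h ↦ hp (key.1 h)
      rw [if_neg hp, if_neg this]
      omega

/-- `Nat.count Nat.Prime n = π(n − 1)` for `1 ≤ n`. [folklore] -/
theorem count_prime_eq_primeCounting {n : ℕ} (hn : 1 ≤ n) :
    Nat.count Nat.Prime n = Nat.primeCounting (n - 1) := by
  rw [Nat.primeCounting, Nat.primeCounting', show n - 1 + 1 = n by omega]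

end Soundness

end BrentSieve

end Literature.NumberTheory.LFunctions
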